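import Summits.QuantumFields.YangMills.Theorems.BalabanUVNodesN21CollarJunctionAtCubeLaw
import Summits.QuantumFields.YangMills.Theorems.BalabanUVNodesN21ShellSplitOfRecord13CoPHFibre

/-!
# N21 (NE7c) · THE COLLAR JUNCTION AT THE RECORD's BLOCK FIBRE LAWS: the collar ENDs 38m ∕ 38n, read through a block
# chart of `(SU N)^b` at a FROZEN EXTERIOR FIELD, give (M1) for `blockFibreLawOfDatum₉ … t a b x`; dag-n21-d's block
# disintegration (FILE 5) and law bridge (FILE 4) then give the per-top-cube (M1) of the shell split of record

R141 (C) seat pub-ymgap-dag-n21-e (g19), node N21 = NE7c (NOT PRINTED in [Bałaban 1983–89], NOT proved), strategy s3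
ALTERNATIVE CURRENCY, lane K3⁷ `SpineGivenEndpointR13SepCoPH` (stmt-QuantumFields-20544, `--kind proof --supports …
--as helper`).  Part 38t — successor of 38s `…N21CollarJunctionAtCubeLaw` (chart transport onto the whole cube law);
consumes BY NAME dag-n21-d g9's FILE 5 `…N21ShellSplitOfRecord13CoPHFibre` ★★★
`slotAntiConcentration_cubeLaw_of_blockFibres` (block disintegration over the exterior), FILE 4 ★★★
`cubeAC_of_slotAntiConcentration`, FILE 1 v1.1 (`blockFibreLawOfDatum₉`, `blockReading`), 38s §1
(`slotAntiConcentration_of_chartLaw_dominated`) and the collar ENDs 38m ∕ 38n ★★★ — dag-n21-d's invitation INTENT-4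
(«your 38s pieces may equally target the block FIBRE laws … on `(SU N)^b`, where parts 24 ∕ 27's chart ∕ Jacobian live»).

WHY.  After FILE 5, N21 AT THE RECORD reads: per (run, K, t, top cube a), bond block `b` and EXTERIOR FIELD `x`, (M1)
`SlotAntiConcentration (blockFibreLawOfDatum₉ … t a b x) (blockReading N u b x) ε_k ρ D` — a law on the FINITE PRODUCT
`(SU N)^b` with an explicit density (the dressed (2.18) integrand, exterior frozen).  This is where a block chart is
honest: a measurable chart `Φ : (↥b → SU N) → Y` of the block (e.g. exponential coordinates about the background, parts
24 ∕ 27) with the block reading factoring as `U ∘ Φ`, and a frame law on `Y` two-sided comparable to the fibre law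
through the chart (ratios `M₁`, `M₂`).  So:
* §1 ★ `fibreAC_of_chart_dominated` (per exterior field: chart + reading identity `r = U ∘ Φ` for any block statistic
  `r` + two-ratio dictionary + (M1) for the frame law ⇒ (M1) for the block fibre law and `r`, constant `D·(M₁·M₂)`; 38s
  §1 BY NAME) · ★ `fibreAC_of_chart` (exact image law, measurable chart);
* §2 ★★ `cubeAC_of_blockFibres` (the knit: (M1) for every block fibre law ⇒ dag-n21-d's integral-form per-top-cube (M1)
  `Σ_s shellPiece ≤ (Dρ)·Σ_s cubeWeight`, FILE 5 ★★★ + FILE 4 ★★★) · ★★ `cubeAC_of_fibreCharts_dominated` (the same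
  from per-exterior-field charts `Φ x`, frame laws `ν' x` and statistics `U x` with UNIFORM constant and ratios);
* §3 ★★★ `fibreAC_of_lowCentre_collar_chart` · ★★★ `fibreAC_of_projectedCentre_collar_chart`: 38m ∕ 38n ★★★'s binders
  on a collar frame `X × (κ → ℝ)` at `θ := ε_k` (for a frozen exterior take `X := Unit`, `ζ := dirac ()` as in 38m′ ∕
  38r′) + chart + dictionary ⇒ (M1) for the block fibre law at `x` with constant `(3(#κ+1)∏ᵢ(1+Qᵢ)∕(κ₀(1−ρ)))·(M₁·M₂)` —
  the input of §2 ★★ at that `x`.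

BINDERS LEFT (displayed; other lanes' objects, none asserted): per exterior field the chart and its two-ratio
dictionary (the frozen-exterior (2.18) block density in exponential coordinates vs. the collar's convex model: NODE O's
term object; Haar's radial Jacobian = dag-n21-d part 24), the reading identity and dag-n21-d's reading clauses
`hu ∕ hu'`, 38m ∕ 38n's per-slot binders as in 38r ∕ 38s, (H-U), (H-ζ), `D.AvgMeasurable`, `0 ≤ w`, F3's (e1)
integrability.  A6 said plainly: §1–§2's fibre-law binders live on NODE 00's objects and are NOT inhabited here (zero
width `ρ = 0`, `D = 0` is the junk instance); the collar frame's binders are inhabited in 38m′ ∕ 38r′ (p590169).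

HONEST FRAMING.  [textbook] by-name composition; 0 def, 0 sorry; nothing of Bałaban's asserted ([Balaban1989LargeFieldI]
p. 176 ∕ p. 193 = the located MECHANISM only); (M1) NOT PRINTED ∕ NOT proved; NE7c NOT proved; N21 NOT discharged; K3⁷
NOT claimed; counts unmoved (typed 28∕28 · discharged 5∕27); count-neutral; one finite 𝕋⁴ at fixed ε — nothing about
ℝ⁴ ∕ OS ∕ mass gap ∕ Clay.
-/

set_option autoImplicit false

open MeasureTheory Set Function Matrix
open scoped ENNReal BigOperators

namespace Summit.QuantumFields.YangMills.Theorems.N21CollarJunctionAtCubeLaw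

open Literature.MathematicalPhysics.QuantumFieldTheory.Balaban1983to89
open Literature.MathematicalPhysics.QuantumFieldTheory.Balaban1983to89.T4Continuum
open Literature.MathematicalPhysics.QuantumFieldTheory.Balaban1983to89.Node00
open Literature.MathematicalPhysics.QuantumFieldTheory.Balaban1983to89.T4ShellMeasure (SlotAntiConcentration)
open Literature.MathematicalPhysics.QuantumFieldTheory.Balaban1983to89.T4ShellMeasureFibre
  (slotAntiConcentration_comap)
open Summit.QuantumFields.YangMills.Theorems.N21ShellSplitOfRecord13CoPH
open Summit.QuantumFields.YangMills.Theorems.N21CollarJunctionLowCentre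
  (slotAntiConcentration_restrict_of_lowCentre_letterwise)
open Summit.QuantumFields.YangMills.Theorems.N21CollarJunctionProjectedCentre
  (slotAntiConcentration_restrict_of_projectedCentre_letterwise)

variable (F : T4Family) (N : ℕ) [NeZero N] (ϑ : Stage9Params F N) (D : FiniteEpsData F (SU N)) (g₀ : ℕ → ℝ)
  (os : List (ULoop F)) (p : B12.RunParams) (g : ℕ → ℝ) (k : ℕ)

/-! ## §1 (M1) for one block fibre law through a block chart -/

section Fibre

/-- **★ (M1) FOR THE BLOCK FIBRE LAW FROM A TWO-SIDED COMPARABLE FRAME LAW.**  At an exterior field `x` and bond block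
`b`: a chart `Φ` of the block configurations `↥b → SU N` into a frame `Y` through which the block statistic `r` factors
(`hread`; `r` = dag-n21-d's `blockReading N u b x`, or FILE 6's exterior-free
`blockReading N (cubeStat … a) (inputBlock … a) (fun _ => 1)`), a frame law `ν'` with (M1) for `U` (constant `D ≥ 0`),
and the dictionary as two inequalities (`hS` ratio `M₁`: the fibre law's shell mass ≤ `M₁`× the frame's; `hmass` ratio
`M₂`: the frame's total mass ≤ `M₂`× the fibre law's).  Then
`SlotAntiConcentration (blockFibreLawOfDatum₉ … t a b x) r θ ρ (D·(M₁·M₂))` — no measurability needed (38s §1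
`slotAntiConcentration_of_chartLaw_dominated` BY NAME). [textbook] -/
theorem fibreAC_of_chart_dominated (t : ℝ)
    (a : ↥(cubeIndices (F.P p.K) (cubeSide (F.P p.K).L ϑ.ν.M₂ (RkOfRecord (F.P p.K).L ϑ.ν.r (g k)) k)))
    (b : Finset (PBond (F.P p.K) k)) (x : GaugeField (F.P p.K) k (SU N)) (r : (↥b → SU N) → ℝ)
    {Y : Type*} [MeasurableSpace Y] (Φ : (↥b → SU N) → Y) (U : Y → ℝ) (hread : ∀ y, r y = U (Φ y))
    (ν' : Measure Y) {θ ρ Dc M₁ M₂ : ℝ} (hD : 0 ≤ Dc) (hρ : 0 ≤ ρ) (hM₁ : 0 ≤ M₁)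
    (hS : blockFibreLawOfDatum₉ F N ϑ D g₀ os p g k t a b x {y | θ * (1 - ρ) ≤ U (Φ y) ∧ U (Φ y) < θ} ≤
      ENNReal.ofReal M₁ * ν' {y | θ * (1 - ρ) ≤ U y ∧ U y < θ})
    (hmass : ν' univ ≤ ENNReal.ofReal M₂ * blockFibreLawOfDatum₉ F N ϑ D g₀ os p g k t a b x univ)
    (hAC : SlotAntiConcentration ν' U θ ρ Dc) :
    SlotAntiConcentration (blockFibreLawOfDatum₉ F N ϑ D g₀ os p g k t a b x) r θ ρ (Dc * (M₁ * M₂)) := by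
  have hfun : r = U ∘ Φ := funext hread
  rw [hfun]
  exact slotAntiConcentration_of_chartLaw_dominated Φ hD hρ hM₁ hS hAC hmass

/-- **★ (M1) FOR THE BLOCK FIBRE LAW FROM THE IMAGE LAW OF A MEASURABLE CHART** (exact dictionary): (M1) for
`(blockFibreLawOfDatum₉ … t a b x).map Φ` and `U` ⇒ (M1) for the fibre law and the block statistic `r = U ∘ Φ`, same constant.
[textbook] -/
theorem fibreAC_of_chart (t : ℝ)
    (a : ↥(cubeIndices (F.P p.K) (cubeSide (F.P p.K).L ϑ.ν.M₂ (RkOfRecord (F.P p.K).L ϑ.ν.r (g k)) k)))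
    (b : Finset (PBond (F.P p.K) k)) (x : GaugeField (F.P p.K) k (SU N)) (r : (↥b → SU N) → ℝ)
    {Y : Type*} [MeasurableSpace Y] {Φ : (↥b → SU N) → Y} (hΦ : Measurable Φ) (U : Y → ℝ)
    (hread : ∀ y, r y = U (Φ y)) {θ ρ Dc : ℝ}
    (hAC : SlotAntiConcentration ((blockFibreLawOfDatum₉ F N ϑ D g₀ os p g k t a b x).map Φ) U θ ρ Dc) :
    SlotAntiConcentration (blockFibreLawOfDatum₉ F N ϑ D g₀ os p g k t a b x) r θ ρ Dc := by
  have hfun : r = U ∘ Φ := funext hread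
  rw [hfun]
  exact slotAntiConcentration_comap hΦ hAC

end Fibre

/-! ## §2 The knit: block fibre laws ⇒ the per-top-cube (M1) of the shell split of record -/

section Knit

/-- **★★ THE KNIT: (M1) FOR EVERY BLOCK FIBRE LAW ⇒ THE INTEGRAL-FORM PER-TOP-CUBE (M1).**  dag-n21-d FILE 5 ★★★
`slotAntiConcentration_cubeLaw_of_blockFibres` composed with FILE 4 ★★★ `cubeAC_of_slotAntiConcentration`: displayed —
(H-U), (H-ζ), `D.AvgMeasurable`, `0 ≤ w`, `0 ≤ ρ`, F3's (e1) integrability, the cube statistic `u` (measurable, reading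
the cube's two tests), `0 ≤ D`, and (M1) for the block fibre law of the truncated law at EVERY exterior field.  Then
`Σ_s shellPiece … ρ t a s ≤ (D ρ)·Σ_s cubeWeight … t a s`. [textbook] -/
theorem cubeAC_of_blockFibres (hU : LocalBgMeasurable F N ϑ.ν) (hζm : ZetaMeasurable F N ϑ.ζ) (hDm : D.AvgMeasurable)
    (hw0 : ∀ k s' U V', 0 ≤ wOfRecord₉ F N ϑ p g k s' U V') {ρ : ℝ} (hρ : 0 ≤ ρ) (t : ℝ)
    (a : ↥(cubeIndices (F.P p.K) (cubeSide (F.P p.K).L ϑ.ν.M₂ (RkOfRecord (F.P p.K).L ϑ.ν.r (g k)) k)))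
    (hint : ∀ s : SeqOfRecord F ϑ.ν ϑ.τ9.M g p.K k,
      Integrable (fun V => chiSeqOfRecord F N ϑ.ν ϑ.τ9.M g p.K k s V * dressedSlotsOfDatum₉ F N ϑ D g₀ os t p g k s V)
        (fieldMeasure (F.P p.K) k (SU N)))
    (b : Finset (PBond (F.P p.K) k)) {u : GaugeField (F.P p.K) k (SU N) → ℝ} (hum : Measurable u)
    (hu : ∀ V, u V < epsOfRecord ϑ.ν g k ↔ cubeChiAt F N ϑ.ν g p.K k (epsOfRecord ϑ.ν g k) a V = 1)
    (hu' : ∀ V, u V < epsOfRecord ϑ.ν g k * (1 - ρ) ↔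
      cubeChiAt F N ϑ.ν g p.K k (epsOfRecord ϑ.ν g k * (1 - ρ)) a V = 1)
    {Dc : ℝ} (hD : 0 ≤ Dc)
    (hfib : ∀ x : GaugeField (F.P p.K) k (SU N),
      SlotAntiConcentration (blockFibreLawOfDatum₉ F N ϑ D g₀ os p g k t a b x) (blockReading N u b x)
        (epsOfRecord ϑ.ν g k) ρ Dc) :
    ∑ s, shellPieceOfDatum₉ F N ϑ D g₀ os p g k ρ t a s ≤
      (Dc * ρ) * ∑ s, cubeWeightOfDatum₉ F N ϑ D g₀ os p g k t a s :=
  cubeAC_of_slotAntiConcentration F N ϑ D g₀ os p g k hU hw0 hρ t a hint u hu hu' hD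
    (slotAntiConcentration_cubeLaw_of_blockFibres F N ϑ D g₀ os p g k hU hζm hDm t a b hum hfib)

/-- **★★ THE KNIT FROM PER-EXTERIOR-FIELD BLOCK CHARTS.**  The same with the fibre (M1) supplied, at every exterior field
`x`, by §1 ★ from a chart `Φ x`, a frame law `ν' x` with (M1) for `U x` (UNIFORM constant `D`) and the two-ratio
dictionary (UNIFORM ratios `M₁`, `M₂`).  Then `Σ_s shellPiece ≤ (D·(M₁·M₂)·ρ)·Σ_s cubeWeight`. [textbook] -/
theorem cubeAC_of_fibreCharts_dominated (hU : LocalBgMeasurable F N ϑ.ν) (hζm : ZetaMeasurable F N ϑ.ζ)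
    (hDm : D.AvgMeasurable) (hw0 : ∀ k s' U V', 0 ≤ wOfRecord₉ F N ϑ p g k s' U V') {ρ : ℝ} (hρ : 0 ≤ ρ) (t : ℝ)
    (a : ↥(cubeIndices (F.P p.K) (cubeSide (F.P p.K).L ϑ.ν.M₂ (RkOfRecord (F.P p.K).L ϑ.ν.r (g k)) k)))
    (hint : ∀ s : SeqOfRecord F ϑ.ν ϑ.τ9.M g p.K k,
      Integrable (fun V => chiSeqOfRecord F N ϑ.ν ϑ.τ9.M g p.K k s V * dressedSlotsOfDatum₉ F N ϑ D g₀ os t p g k s V)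
        (fieldMeasure (F.P p.K) k (SU N)))
    (b : Finset (PBond (F.P p.K) k)) {u : GaugeField (F.P p.K) k (SU N) → ℝ} (hum : Measurable u)
    (hu : ∀ V, u V < epsOfRecord ϑ.ν g k ↔ cubeChiAt F N ϑ.ν g p.K k (epsOfRecord ϑ.ν g k) a V = 1)
    (hu' : ∀ V, u V < epsOfRecord ϑ.ν g k * (1 - ρ) ↔
      cubeChiAt F N ϑ.ν g p.K k (epsOfRecord ϑ.ν g k * (1 - ρ)) a V = 1)
    {Y : Type*} [MeasurableSpace Y] (Φ : GaugeField (F.P p.K) k (SU N) → (↥b → SU N) → Y)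
    (U : GaugeField (F.P p.K) k (SU N) → Y → ℝ) (hread : ∀ x y, blockReading N u b x y = U x (Φ x y))
    (ν' : GaugeField (F.P p.K) k (SU N) → Measure Y) {Dc M₁ M₂ : ℝ} (hD : 0 ≤ Dc) (hM₁ : 0 ≤ M₁) (hM₂ : 0 ≤ M₂)
    (hS : ∀ x, blockFibreLawOfDatum₉ F N ϑ D g₀ os p g k t a b x
        {y | epsOfRecord ϑ.ν g k * (1 - ρ) ≤ U x (Φ x y) ∧ U x (Φ x y) < epsOfRecord ϑ.ν g k} ≤
      ENNReal.ofReal M₁ * ν' x {y | epsOfRecord ϑ.ν g k * (1 - ρ) ≤ U x y ∧ U x y < epsOfRecord ϑ.ν g k})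
    (hmass : ∀ x, ν' x univ ≤ ENNReal.ofReal M₂ * blockFibreLawOfDatum₉ F N ϑ D g₀ os p g k t a b x univ)
    (hAC : ∀ x, SlotAntiConcentration (ν' x) (U x) (epsOfRecord ϑ.ν g k) ρ Dc) :
    ∑ s, shellPieceOfDatum₉ F N ϑ D g₀ os p g k ρ t a s ≤
      (Dc * (M₁ * M₂) * ρ) * ∑ s, cubeWeightOfDatum₉ F N ϑ D g₀ os p g k t a s :=
  cubeAC_of_blockFibres F N ϑ D g₀ os p g k hU hζm hDm hw0 hρ t a hint b hum hu hu' (mul_nonneg hD (mul_nonneg hM₁ hM₂))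
    fun x => fibreAC_of_chart_dominated F N ϑ D g₀ os p g k t a b x (blockReading N u b x) (Φ x) (U x) (hread x) (ν' x)
      hD hρ hM₁ (hS x) (hmass x) (hAC x)

end Knit

/-! ## §3 The collar ENDs at one block fibre law -/

section Collar

variable {X : Type*} [MeasurableSpace X] {κ : Type*} [Fintype κ] [DecidableEq κ]

/-- **★★★ THE LOW-CENTRE COLLAR END AT A BLOCK FIBRE LAW.**  38m ★★★'s frame and binders at `θ := ε_k` (exterior law
`ζ` on `X` — for a frozen exterior `X := Unit`, `ζ := dirac ()` —, block `κ → ℝ`, density `𝟙_K·e^{−φ}` with convex kept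
cuts and convex potential, a measurable LOW centre, cut event, letters, species odds `Qᵢ`, radial transversality `κ₀`,
core), a chart `Φ` of `↥b → SU N` into the frame through which the block statistic `r` factors, and the two-ratio
dictionary against the frame law `ν|({U<ε_k} ∩ C)`.  Then
`SlotAntiConcentration (blockFibreLawOfDatum₉ … t a b x) r ε_k ρ ((3(#κ+1)∏ᵢ(1+Qᵢ)∕(κ₀(1−ρ)))·(M₁·M₂))` — with
`r := blockReading N u b x` the input of §2 ★★ `cubeAC_of_blockFibres` at `x`. [textbook] -/
theorem fibreAC_of_lowCentre_collar_chart (t : ℝ)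
    (a : ↥(cubeIndices (F.P p.K) (cubeSide (F.P p.K).L ϑ.ν.M₂ (RkOfRecord (F.P p.K).L ϑ.ν.r (g k)) k)))
    (b : Finset (PBond (F.P p.K) k)) (x : GaugeField (F.P p.K) k (SU N)) (r : (↥b → SU N) → ℝ)
    -- the frame (38m ★★★'s data and binders, `θ := ε_k`)
    [Nonempty κ] (ζ : Measure X) [SFinite ζ]
    {m : X → (κ → ℝ)} (hm : Measurable m) (K : X → Set (κ → ℝ)) (φ : X → (κ → ℝ) → ℝ)
    (hg : Measurable fun q : X × (κ → ℝ) =>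
      (K q.1).indicator (fun w => ENNReal.ofReal (Real.exp (-φ q.1 w))) q.2)
    [IsFiniteMeasure ((ζ.prod volume).withDensity fun q : X × (κ → ℝ) =>
      (K q.1).indicator (fun w => ENNReal.ofReal (Real.exp (-φ q.1 w))) q.2)]
    {U : X × (κ → ℝ) → ℝ} (hUm : Measurable U)
    {Cstar : Set (X × (κ → ℝ))} (hCstar : MeasurableSet Cstar)
    (Mc : Finset κ) (P₁ E₁ : κ → Set ℝ) (hP₁ : ∀ i ∈ Mc, MeasurableSet (P₁ i))
    (hE₁ : ∀ i ∈ Mc, MeasurableSet (E₁ i)) (hPE : ∀ i ∈ Mc, P₁ i ⊆ E₁ i) (Q : κ → ℝ) (hQ0 : ∀ i ∈ Mc, 0 ≤ Q i)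
    (hodds : ∀ i ∈ Mc, ∀ C : Set (X × (κ → ℝ)), MeasurableSet C →
      (∀ (z : X) (w : κ → ℝ) (y : ℝ), (z, update w i y) ∈ C ↔ (z, w) ∈ C) →
      ((ζ.prod volume).withDensity fun q : X × (κ → ℝ) =>
          (K q.1).indicator (fun w => ENNReal.ofReal (Real.exp (-φ q.1 w))) q.2)
          (({q | q.2 i ∈ E₁ i} \ {q | q.2 i ∈ P₁ i}) ∩ C)
        ≤ ENNReal.ofReal (Q i) *
          ((ζ.prod volume).withDensity fun q : X × (κ → ℝ) =>
            (K q.1).indicator (fun w => ENNReal.ofReal (Real.exp (-φ q.1 w))) q.2) ({q | q.2 i ∈ P₁ i} ∩ C))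
    (hUi : ∀ i ∈ Mc, ∀ (z : X) (w : κ → ℝ) (y : ℝ), U (z, update w i y) = U (z, w))
    (hCi : ∀ i ∈ Mc, ∀ (z : X) (w : κ → ℝ) (y : ℝ), (z, update w i y) ∈ Cstar ↔ (z, w) ∈ Cstar)
    {ρ κ₀ : ℝ} (hε : 0 < epsOfRecord ϑ.ν g k) (hρ0 : 0 < ρ) (hρ1 : ρ < 1) (hκ : 0 < κ₀)
    (hK : ∀ z, Convex ℝ (K z)) (hφ : ∀ z, ConvexOn ℝ (K z) (φ z)) (hmK : ∀ z, m z ∈ K z)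
    (hlow : ∀ q : X × (κ → ℝ), epsOfRecord ϑ.ν g k * (1 - ρ) ≤ U q → U q < epsOfRecord ϑ.ν g k →
      q ∈ Cstar ∩ ⋂ i ∈ Mc, {q : X × (κ → ℝ) | q.2 i ∈ P₁ i} → q.2 ∈ K q.1 →
        φ q.1 (m q.1) ≤ φ q.1 (m q.1 + (1 - 1 / ((Fintype.card κ : ℝ) + 1)) • (q.2 - m q.1)))
    (hletter : ∀ i ∈ Mc, ∀ l ∈ Icc (1 - 1 / ((Fintype.card κ : ℝ) + 1)) 1, ∀ (z : X) (w : κ → ℝ),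
      w i ∈ P₁ i → (m z + l • (w - m z)) i ∈ E₁ i)
    (hcore : ∀ l ∈ Icc (1 - 1 / ((Fintype.card κ : ℝ) + 1)) 1, ∀ q : X × (κ → ℝ),
      epsOfRecord ϑ.ν g k * (1 - ρ) ≤ U q → U q < epsOfRecord ϑ.ν g k → q ∈ Cstar →
        (q.1, m q.1 + l • (q.2 - m q.1)) ∈ {q : X × (κ → ℝ) | U q < epsOfRecord ϑ.ν g k} ∩ Cstar)
    (hRT : ∀ q : X × (κ → ℝ), epsOfRecord ϑ.ν g k * (1 - ρ) ≤ U q → U q < epsOfRecord ϑ.ν g k →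
      q ∈ Cstar ∩ ⋂ i ∈ Mc, {q : X × (κ → ℝ) | q.2 i ∈ P₁ i} → ∀ s : ℝ, 1 ≤ s →
      epsOfRecord ϑ.ν g k * (1 - ρ) ≤ U (q.1, m q.1 + s • (q.2 - m q.1)) →
        U (q.1, m q.1 + s • (q.2 - m q.1)) < epsOfRecord ϑ.ν g k →
        (q.1, m q.1 + s • (q.2 - m q.1)) ∈ Cstar ∩ ⋂ i ∈ Mc, {q : X × (κ → ℝ) | q.2 i ∈ P₁ i} →
          U q + κ₀ * (epsOfRecord ϑ.ν g k * (1 - ρ)) * (s - 1) ≤ U (q.1, m q.1 + s • (q.2 - m q.1)))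
    -- the block chart, the reading identity and the dictionary
    (Φ : (↥b → SU N) → X × (κ → ℝ)) (hread : ∀ y, r y = U (Φ y))
    {M₁ M₂ : ℝ} (hM₁ : 0 ≤ M₁)
    (hS : blockFibreLawOfDatum₉ F N ϑ D g₀ os p g k t a b x
        {y | epsOfRecord ϑ.ν g k * (1 - ρ) ≤ U (Φ y) ∧ U (Φ y) < epsOfRecord ϑ.ν g k} ≤
      ENNReal.ofReal M₁ * (((ζ.prod volume).withDensity fun q : X × (κ → ℝ) =>
          (K q.1).indicator (fun w => ENNReal.ofReal (Real.exp (-φ q.1 w))) q.2).restrict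
        ({q | U q < epsOfRecord ϑ.ν g k} ∩ (Cstar ∩ ⋂ i ∈ Mc, {q : X × (κ → ℝ) | q.2 i ∈ P₁ i})))
        {y | epsOfRecord ϑ.ν g k * (1 - ρ) ≤ U y ∧ U y < epsOfRecord ϑ.ν g k})
    (hmass : (((ζ.prod volume).withDensity fun q : X × (κ → ℝ) =>
          (K q.1).indicator (fun w => ENNReal.ofReal (Real.exp (-φ q.1 w))) q.2).restrict
        ({q | U q < epsOfRecord ϑ.ν g k} ∩ (Cstar ∩ ⋂ i ∈ Mc, {q : X × (κ → ℝ) | q.2 i ∈ P₁ i}))) univ ≤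
      ENNReal.ofReal M₂ * blockFibreLawOfDatum₉ F N ϑ D g₀ os p g k t a b x univ) :
    SlotAntiConcentration (blockFibreLawOfDatum₉ F N ϑ D g₀ os p g k t a b x) r (epsOfRecord ϑ.ν g k) ρ
      ((3 * ((Fintype.card κ : ℝ) + 1) * (∏ i ∈ Mc, (1 + Q i)) / (κ₀ * (1 - ρ))) * (M₁ * M₂)) := by
  have hD : 0 ≤ 3 * ((Fintype.card κ : ℝ) + 1) * (∏ i ∈ Mc, (1 + Q i)) / (κ₀ * (1 - ρ)) :=
    div_nonneg (mul_nonneg (by positivity) (Finset.prod_nonneg fun i hi => by linarith [hQ0 i hi]))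
      (mul_nonneg hκ.le (by linarith))
  exact fibreAC_of_chart_dominated F N ϑ D g₀ os p g k t a b x r Φ U hread _ hD hρ0.le hM₁ hS hmass
    (slotAntiConcentration_restrict_of_lowCentre_letterwise ζ hm K φ hg hUm hCstar Mc P₁ E₁ hP₁ hE₁ hPE Q hQ0 hodds
      hUi hCi hε hρ0 hρ1 hκ hK hφ hmK hlow hletter hcore hRT)

/-- **★★★ THE PROJECTED-CENTRE COLLAR END AT A BLOCK FIBRE LAW.**  The same with 38n ★★★'s frame (quadratic-plus-Lipschitz
exponent about `m`, `A` symmetric `γ`-coercive, dilation centre `c z ∈ K z`, obtuse cross terms, `2G∕γ`-farness).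
[textbook] -/
theorem fibreAC_of_projectedCentre_collar_chart (t : ℝ)
    (a : ↥(cubeIndices (F.P p.K) (cubeSide (F.P p.K).L ϑ.ν.M₂ (RkOfRecord (F.P p.K).L ϑ.ν.r (g k)) k)))
    (b : Finset (PBond (F.P p.K) k)) (x : GaugeField (F.P p.K) k (SU N)) (r : (↥b → SU N) → ℝ)
    -- the frame (38n ★★★'s data and binders, `θ := ε_k`)
    [Nonempty κ] (ζ : Measure X) [SFinite ζ]
    (K : X → Set (κ → ℝ)) (A : Matrix κ κ ℝ) (hA : A.IsSymm) {γ G : ℝ} (hγ0 : 0 < γ)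
    (hγ : ∀ x : κ → ℝ, γ * ‖x‖ ^ 2 ≤ x ⬝ᵥ (A *ᵥ x))
    (m : X → (κ → ℝ)) {c : X → (κ → ℝ)} (hc : Measurable c) (P : X → (κ → ℝ) → ℝ)
    (hg : Measurable fun q : X × (κ → ℝ) => (K q.1).indicator (fun w => ENNReal.ofReal (Real.exp
      (-(1 / 2 * ((w - m q.1) ⬝ᵥ (A *ᵥ (w - m q.1))) + P q.1 w)))) q.2)
    [IsFiniteMeasure ((ζ.prod volume).withDensity fun q : X × (κ → ℝ) => (K q.1).indicator (fun w =>
      ENNReal.ofReal (Real.exp (-(1 / 2 * ((w - m q.1) ⬝ᵥ (A *ᵥ (w - m q.1))) + P q.1 w)))) q.2)]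
    {U : X × (κ → ℝ) → ℝ} (hUm : Measurable U)
    {Cstar : Set (X × (κ → ℝ))} (hCstar : MeasurableSet Cstar)
    (Mc : Finset κ) (P₁ E₁ : κ → Set ℝ) (hP₁ : ∀ i ∈ Mc, MeasurableSet (P₁ i))
    (hE₁ : ∀ i ∈ Mc, MeasurableSet (E₁ i)) (hPE : ∀ i ∈ Mc, P₁ i ⊆ E₁ i) (Q : κ → ℝ) (hQ0 : ∀ i ∈ Mc, 0 ≤ Q i)
    (hodds : ∀ i ∈ Mc, ∀ C : Set (X × (κ → ℝ)), MeasurableSet C →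
      (∀ (z : X) (w : κ → ℝ) (y : ℝ), (z, update w i y) ∈ C ↔ (z, w) ∈ C) →
      ((ζ.prod volume).withDensity fun q : X × (κ → ℝ) => (K q.1).indicator (fun w => ENNReal.ofReal (Real.exp
          (-(1 / 2 * ((w - m q.1) ⬝ᵥ (A *ᵥ (w - m q.1))) + P q.1 w)))) q.2)
          (({q | q.2 i ∈ E₁ i} \ {q | q.2 i ∈ P₁ i}) ∩ C)
        ≤ ENNReal.ofReal (Q i) *
          ((ζ.prod volume).withDensity fun q : X × (κ → ℝ) => (K q.1).indicator (fun w => ENNReal.ofReal (Real.exp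
            (-(1 / 2 * ((w - m q.1) ⬝ᵥ (A *ᵥ (w - m q.1))) + P q.1 w)))) q.2) ({q | q.2 i ∈ P₁ i} ∩ C))
    (hUi : ∀ i ∈ Mc, ∀ (z : X) (w : κ → ℝ) (y : ℝ), U (z, update w i y) = U (z, w))
    (hCi : ∀ i ∈ Mc, ∀ (z : X) (w : κ → ℝ) (y : ℝ), (z, update w i y) ∈ Cstar ↔ (z, w) ∈ Cstar)
    {ρ κ₀ : ℝ} (hε : 0 < epsOfRecord ϑ.ν g k) (hρ0 : 0 < ρ) (hρ1 : ρ < 1) (hκ : 0 < κ₀)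
    (hK : ∀ z, Convex ℝ (K z)) (hcK : ∀ z, c z ∈ K z)
    (hP : ∀ z, ∀ v ∈ K z, ∀ v' ∈ K z, P z v - P z v' ≤ G * ‖v - v'‖)
    (hobt : ∀ q : X × (κ → ℝ), epsOfRecord ϑ.ν g k * (1 - ρ) ≤ U q → U q < epsOfRecord ϑ.ν g k →
      q ∈ Cstar ∩ ⋂ i ∈ Mc, {q : X × (κ → ℝ) | q.2 i ∈ P₁ i} → q.2 ∈ K q.1 →
        0 ≤ (c q.1 - m q.1) ⬝ᵥ (A *ᵥ (q.2 - c q.1)))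
    (hfar : ∀ q : X × (κ → ℝ), epsOfRecord ϑ.ν g k * (1 - ρ) ≤ U q → U q < epsOfRecord ϑ.ν g k →
      q ∈ Cstar ∩ ⋂ i ∈ Mc, {q : X × (κ → ℝ) | q.2 i ∈ P₁ i} → q.2 ∈ K q.1 → 2 * G ≤ γ * ‖q.2 - c q.1‖)
    (hletter : ∀ i ∈ Mc, ∀ l ∈ Icc (1 - 1 / ((Fintype.card κ : ℝ) + 1)) 1, ∀ (z : X) (w : κ → ℝ),
      w i ∈ P₁ i → (c z + l • (w - c z)) i ∈ E₁ i)
    (hcore : ∀ l ∈ Icc (1 - 1 / ((Fintype.card κ : ℝ) + 1)) 1, ∀ q : X × (κ → ℝ),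
      epsOfRecord ϑ.ν g k * (1 - ρ) ≤ U q → U q < epsOfRecord ϑ.ν g k → q ∈ Cstar →
        (q.1, c q.1 + l • (q.2 - c q.1)) ∈ {q : X × (κ → ℝ) | U q < epsOfRecord ϑ.ν g k} ∩ Cstar)
    (hRT : ∀ q : X × (κ → ℝ), epsOfRecord ϑ.ν g k * (1 - ρ) ≤ U q → U q < epsOfRecord ϑ.ν g k →
      q ∈ Cstar ∩ ⋂ i ∈ Mc, {q : X × (κ → ℝ) | q.2 i ∈ P₁ i} → ∀ s : ℝ, 1 ≤ s →
      epsOfRecord ϑ.ν g k * (1 - ρ) ≤ U (q.1, c q.1 + s • (q.2 - c q.1)) →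
        U (q.1, c q.1 + s • (q.2 - c q.1)) < epsOfRecord ϑ.ν g k →
        (q.1, c q.1 + s • (q.2 - c q.1)) ∈ Cstar ∩ ⋂ i ∈ Mc, {q : X × (κ → ℝ) | q.2 i ∈ P₁ i} →
          U q + κ₀ * (epsOfRecord ϑ.ν g k * (1 - ρ)) * (s - 1) ≤ U (q.1, c q.1 + s • (q.2 - c q.1)))
    -- the block chart, the reading identity and the dictionary
    (Φ : (↥b → SU N) → X × (κ → ℝ)) (hread : ∀ y, r y = U (Φ y))
    {M₁ M₂ : ℝ} (hM₁ : 0 ≤ M₁)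
    (hS : blockFibreLawOfDatum₉ F N ϑ D g₀ os p g k t a b x
        {y | epsOfRecord ϑ.ν g k * (1 - ρ) ≤ U (Φ y) ∧ U (Φ y) < epsOfRecord ϑ.ν g k} ≤
      ENNReal.ofReal M₁ * (((ζ.prod volume).withDensity fun q : X × (κ → ℝ) => (K q.1).indicator (fun w =>
          ENNReal.ofReal (Real.exp (-(1 / 2 * ((w - m q.1) ⬝ᵥ (A *ᵥ (w - m q.1))) + P q.1 w)))) q.2).restrict
        ({q | U q < epsOfRecord ϑ.ν g k} ∩ (Cstar ∩ ⋂ i ∈ Mc, {q : X × (κ → ℝ) | q.2 i ∈ P₁ i})))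
        {y | epsOfRecord ϑ.ν g k * (1 - ρ) ≤ U y ∧ U y < epsOfRecord ϑ.ν g k})
    (hmass : (((ζ.prod volume).withDensity fun q : X × (κ → ℝ) => (K q.1).indicator (fun w => ENNReal.ofReal
        (Real.exp (-(1 / 2 * ((w - m q.1) ⬝ᵥ (A *ᵥ (w - m q.1))) + P q.1 w)))) q.2).restrict
        ({q | U q < epsOfRecord ϑ.ν g k} ∩ (Cstar ∩ ⋂ i ∈ Mc, {q : X × (κ → ℝ) | q.2 i ∈ P₁ i}))) univ ≤
      ENNReal.ofReal M₂ * blockFibreLawOfDatum₉ F N ϑ D g₀ os p g k t a b x univ) :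
    SlotAntiConcentration (blockFibreLawOfDatum₉ F N ϑ D g₀ os p g k t a b x) r (epsOfRecord ϑ.ν g k) ρ
      ((3 * ((Fintype.card κ : ℝ) + 1) * (∏ i ∈ Mc, (1 + Q i)) / (κ₀ * (1 - ρ))) * (M₁ * M₂)) := by
  have hD : 0 ≤ 3 * ((Fintype.card κ : ℝ) + 1) * (∏ i ∈ Mc, (1 + Q i)) / (κ₀ * (1 - ρ)) :=
    div_nonneg (mul_nonneg (by positivity) (Finset.prod_nonneg fun i hi => by linarith [hQ0 i hi]))
      (mul_nonneg hκ.le (by linarith))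
  exact fibreAC_of_chart_dominated F N ϑ D g₀ os p g k t a b x r Φ U hread _ hD hρ0.le hM₁ hS hmass
    (slotAntiConcentration_restrict_of_projectedCentre_letterwise ζ K A hA hγ0 hγ m hc P hg hUm hCstar Mc P₁ E₁ hP₁
      hE₁ hPE Q hQ0 hodds hUi hCi hε hρ0 hρ1 hκ hK hcK hP hobt hfar hletter hcore hRT)

end Collar

end Summit.QuantumFields.YangMills.Theorems.N21CollarJunctionAtCubeLaw
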